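import Literature.Analysis.FluidPDE.Tao2016AveragedNS.SeedScaleIgnition
import HarnessLib

/-!
# The trigger-level hitting time of an approximate trajectory at the seed scale

Cell `pub-fluidc`, blueprint seat 1 (gen 13) — the ENTRY POINT of the firing analysis for
approximate trajectories (successor option (F2)). HONEST FRAMING: low prior, high
value-of-information experiment on Tao's machine paradigm [Tao2016AveragedNS, §5.5]; NOT a claim
that NS blows up.

`Thm53With` (RetunedTransition.lean) proves Theorem 5.3 for the EXACT flow of a member
`delayCircuitWith K M ε` from (5.6) in two halves glued at the first hitting time `t_c` of the
trigger level `ε²/K¹⁰` by `c` (`Thm53With.tc_window`: `1 ≤ t_c ≤ 3/2`, `c(t_c) = ε²/K¹⁰`). This file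
produces the same hitting time, WITH ITS ENTRY STATE, for every differentiable approximate
trajectory `Y` (velocity `V`, sup-defect `‖V - F(Y)‖ ≤ δ` on `[0,T)`, sup-ball `2`, `T ≥ 2`) issued
`δ₀`-close to (5.6) with the seed-scale budget `δ₀ + 2δ ≤ ε²e^{-M}/(8√M)` of SeedScaleIgnition.lean:

* `Ignition.exists_triggerLevel_hit`: there is `τ ∈ (1, 8/5]` with `c(τ) = ε²/K¹⁰` (positive sign),
  `|c| < ε²/K¹⁰` on `[0, τ)`, `c > 0` on `[1/√M, τ]`, the clock running (`b ≥ (49/50)ε` on `[1, τ]`,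
  `|b| ≤ 2ε` on `[0, τ]`), the carrier intact (`a² ≥ 999/1000` on `[0, τ]`) and the outputs still
  off (`|d|, |ã| ≤ 4/K¹⁰` on `[0, τ]`);
* `triggerLevel_hit`: the same with all hypotheses explicit and the budget as `δ₀ + δT ≤ ε²e^{-M}/(8√M)`.

Ingredients: the `[0, 8/5]`-window lemmas of SeedScaleIgnition.lean re-run on a variable horizon
`[0, τ]` (`*_of_smallH`), a rotor-output bound under a trigger bound `|c| ≤ C`
(`de_le_of_abs_c_le`: `|d|, |ã| ≤ 2δ₀ + (2δ + 2C/ε²)t`), the infimum of the closed set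
`{t ∈ [0, 8/5] : |c(t)| ≥ ε²/K¹⁰}` (non-empty by `exists_abs_c_gt_sq`) and the intermediate value
theorem. What is NOT here: anything after `τ` (Tao's (c-large), equipartition, (toke) with a defect).

Layout note: the lemmas of `section Seed` whose proofs use the budget only through
`budget_facts'` (`δ₀ + 2δ ≤ ε²e^{-M}/8`) are proved under that WEAK budget in `section Eighth` (primed
names) and re-exported with unchanged statements under the seed-scale budget `ε²e^{-M}/(8√M)`, so that
the sharp-budget chain (SeedScaleSharp*.lean) can reuse them.
-/

namespace Literature.Analysis.FluidPDE.Tao2016AveragedNS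

open Real Set MeasureTheory
open scoped NNReal
open NegKick (clockInt clockInt_zero)

namespace Ignition

section Approx

variable {K M ε δ δ₀ T : ℝ} {Y V : ℝ → Fin 5 → ℝ}
  (hY : ∀ t, HasDerivAt Y (V t) t)
  (hV : ∀ t ∈ Ico 0 T, ‖V t - delayCircuitWith K M ε (Y t)‖ ≤ δ)
  (hR : ∀ t ∈ Ico 0 T, ‖Y t‖ ≤ 2) (hT : 2 ≤ T)
include hY hV hR hT

/-! ## §1. The rotor outputs under a trigger bound -/

/-- **Outputs under a trigger bound.** If `|c| ≤ C` on `[0, τ]`, `τ ≤ 8/5`, then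
`|d(t)|, |ã(t)| ≤ 2δ₀ + (2δ + 2C/ε²)·t` for `t ∈ [0, τ]`: along `h = √(d² + ã² + μ²)` the pump terms
cancel (`d·(-Kdã) + ã·(Kd²) = 0`) and `ḣ ≤ ε⁻²|c||a| + 2δ ≤ 2C/ε² + 2δ` (`|a| ≤ 2`).
[cite: Tao2016AveragedNS, §5.5 (5.5)] -/
theorem de_le_of_abs_c_le (h0 : ‖Y 0 - delayInit‖ ≤ δ₀) (hε : 0 < ε) {C τ : ℝ} (hC : 0 ≤ C)
    (hτ : τ ≤ 8 / 5) (hc : ∀ s ∈ Icc (0 : ℝ) τ, |Y s 2| ≤ C) {t : ℝ} (ht : t ∈ Icc (0 : ℝ) τ) :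
    |Y t 3| ≤ 2 * δ₀ + (2 * δ + 2 * C / ε ^ 2) * t ∧
      |Y t 4| ≤ 2 * δ₀ + (2 * δ + 2 * C / ε ^ 2) * t := by
  have hδ := defect_nonneg hV hT
  obtain ⟨ρ, hρ⟩ : ∃ ρ : ℝ, ρ = 2 * δ + 2 * C / ε ^ 2 := ⟨_, rfl⟩
  have hρ0 : 0 ≤ ρ := by rw [hρ]; positivity
  obtain ⟨u, hu⟩ : ∃ u : ℝ → ℝ, u = fun s => Y s 3 * Y s 3 + Y s 4 * Y s 4 := ⟨_, rfl⟩
  obtain ⟨hd0, he0⟩ := (abs_init_coord_le h0).2.2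
  rw [← hρ]
  suffices hmain : ∀ μ : ℝ, 0 < μ → Real.sqrt (u t + μ ^ 2) ≤ 2 * δ₀ + μ + ρ * t by
    have hd : ∀ μ : ℝ, 0 < μ → |Y t 3| ≤ 2 * δ₀ + ρ * t + μ := fun μ hμ => by
      have : |Y t 3| ≤ Real.sqrt (u t + μ ^ 2) :=
        abs_le_sqrt (by rw [hu]; nlinarith [mul_self_nonneg (Y t 4)])
      linarith [hmain μ hμ]
    have he : ∀ μ : ℝ, 0 < μ → |Y t 4| ≤ 2 * δ₀ + ρ * t + μ := fun μ hμ => by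
      have : |Y t 4| ≤ Real.sqrt (u t + μ ^ 2) :=
        abs_le_sqrt (by rw [hu]; nlinarith [mul_self_nonneg (Y t 3)])
      linarith [hmain μ hμ]
    exact ⟨le_of_forall_pos_le_add fun μ hμ => hd μ hμ,
      le_of_forall_pos_le_add fun μ hμ => he μ hμ⟩
  intro μ hμ
  have hupos : ∀ s, 0 < u s + μ ^ 2 := fun s => by
    have : 0 ≤ u s := by rw [hu]; nlinarith [mul_self_nonneg (Y s 3), mul_self_nonneg (Y s 4)]
    positivity
  have hdu : ∀ s, HasDerivAt u (Y s 3 * V s 3 + Y s 3 * V s 3 + (Y s 4 * V s 4 + Y s 4 * V s 4)) s :=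
    fun s => by
      have h3 := hasDerivAt_coord (hY s) 3
      have h4 := hasDerivAt_coord (hY s) 4
      rw [hu]
      exact ((h3.mul h3).add (h4.mul h4)).congr_deriv (by ring)
  have hder : ∀ s, HasDerivAt (fun s => Real.sqrt (u s + μ ^ 2))
      ((Y s 3 * V s 3 + Y s 3 * V s 3 + (Y s 4 * V s 4 + Y s 4 * V s 4)) /
        (2 * Real.sqrt (u s + μ ^ 2))) s := fun s =>
    ((hdu s).add_const (μ ^ 2)).sqrt (hupos s).ne'
  have hbound : ∀ s ∈ Icc (0 : ℝ) τ,
      (Y s 3 * V s 3 + Y s 3 * V s 3 + (Y s 4 * V s 4 + Y s 4 * V s 4)) /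
        (2 * Real.sqrt (u s + μ ^ 2)) ≤ ρ := by
    intro s hs
    have hs' : s ∈ Icc (0 : ℝ) (8 / 5) := ⟨hs.1, hs.2.trans hτ⟩
    have hhpos : 0 < Real.sqrt (u s + μ ^ 2) := Real.sqrt_pos.2 (hupos s)
    rw [div_le_iff₀ (by positivity)]
    have hVs := hV s (mem_Ico_of_mem_window hT hs')
    have hθ3 := abs_coord_defect_le hVs 3
    have hθ4 := abs_coord_defect_le hVs 4
    rw [field_three] at hθ3
    rw [field_four] at hθ4
    have hcs : |Y s 2| ≤ C := hc s hs
    have ha : |Y s 0| ≤ 2 := abs_apply_le_of_norm_le (hR s (mem_Ico_of_mem_window hT hs')) 0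
    have hds : |Y s 3| ≤ Real.sqrt (u s + μ ^ 2) :=
      abs_le_sqrt (by rw [hu]; nlinarith [mul_self_nonneg (Y s 4)])
    have hes : |Y s 4| ≤ Real.sqrt (u s + μ ^ 2) :=
      abs_le_sqrt (by rw [hu]; nlinarith [mul_self_nonneg (Y s 3)])
    have hid : Y s 3 * V s 3 + Y s 4 * V s 4 =
        Y s 3 * (V s 3 - ((ε ^ 2)⁻¹ * Y s 2 * Y s 0 - K * Y s 3 * Y s 4)) +
        Y s 4 * (V s 4 - K * Y s 3 ^ 2) + (ε ^ 2)⁻¹ * (Y s 2 * Y s 0 * Y s 3) := by ring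
    have h1 : |Y s 3 * (V s 3 - ((ε ^ 2)⁻¹ * Y s 2 * Y s 0 - K * Y s 3 * Y s 4))| ≤
        Real.sqrt (u s + μ ^ 2) * δ := by
      rw [abs_mul]; exact mul_le_mul hds hθ3 (abs_nonneg _) hhpos.le
    have h2 : |Y s 4 * (V s 4 - K * Y s 3 ^ 2)| ≤ Real.sqrt (u s + μ ^ 2) * δ := by
      rw [abs_mul]; exact mul_le_mul hes hθ4 (abs_nonneg _) hhpos.le
    have h3 : |(ε ^ 2)⁻¹ * (Y s 2 * Y s 0 * Y s 3)| ≤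
        (ε ^ 2)⁻¹ * (C * 2 * Real.sqrt (u s + μ ^ 2)) := by
      rw [abs_mul, abs_of_pos (by positivity : (0 : ℝ) < (ε ^ 2)⁻¹), abs_mul, abs_mul]
      refine mul_le_mul_of_nonneg_left ?_ (by positivity)
      exact mul_le_mul (mul_le_mul hcs ha (abs_nonneg _) hC) hds (abs_nonneg _) (by positivity)
    have h3' : (ε ^ 2)⁻¹ * (C * 2 * Real.sqrt (u s + μ ^ 2)) =
        2 * C / ε ^ 2 * Real.sqrt (u s + μ ^ 2) := by field_simp
    rw [h3'] at h3
    have e1 := (le_abs_self _).trans h1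
    have e2 := (le_abs_self _).trans h2
    have e3 := (le_abs_self _).trans h3
    have hsum : Y s 3 * V s 3 + Y s 4 * V s 4 ≤ ρ * Real.sqrt (u s + μ ^ 2) := by
      rw [hid, hρ]
      linarith
    linarith
  have hanti := Thm53.antitoneOn_sub_of_deriv_le (Φ := fun s => ρ * s)
    (convex_Icc (0 : ℝ) τ) (fun s _ => hder s)
    (fun s _ => ((hasDerivAt_id s).const_mul ρ).congr_deriv (by simp)) hbound
  have hmono := hanti (left_mem_Icc.2 (ht.1.trans ht.2)) ht ht.1
  have hh0 : Real.sqrt (u 0 + μ ^ 2) ≤ 2 * δ₀ + μ := by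
    rw [hu]
    have hsq : Y 0 3 * Y 0 3 + Y 0 4 * Y 0 4 + μ ^ 2 ≤ (|Y 0 3| + |Y 0 4| + μ) ^ 2 :=
      sq_add_sq_add_sq_le _ _ _ hμ.le
    calc Real.sqrt (Y 0 3 * Y 0 3 + Y 0 4 * Y 0 4 + μ ^ 2)
        ≤ Real.sqrt ((|Y 0 3| + |Y 0 4| + μ) ^ 2) := Real.sqrt_le_sqrt hsq
      _ = |Y 0 3| + |Y 0 4| + μ := Real.sqrt_sq (by positivity)
      _ ≤ 2 * δ₀ + μ := by linarith
  simp only [mul_zero, sub_zero] at hmono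
  linarith

/-! ## §2. The window lemmas on a variable horizon `[0, τ]`, `τ ≤ 8/5` -/

section Eighth

/-! ### The same, under the WEAK budget `δ₀ + 2δ ≤ ε²e^{-M}/8` (primed names; the unprimed
names below re-export them under the seed-scale budget with unchanged statements) -/

variable (hK : 2 * 20 ^ 42 * (Nat.factorial 42 : ℝ) + 16 ≤ K) (hML : 3000 * Real.log K ≤ M)
  (hMK : M ≤ K ^ 10) (hε : 0 < ε) (hεle : ε ≤ exp (-(10 * M)) / K ^ 100)
  (h0 : ‖Y 0 - delayInit‖ ≤ δ₀) (hη : δ₀ + 2 * δ ≤ ε ^ 2 * exp (-M) / 8)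
include hK hML hMK hε hεle h0 hη

omit hR h0 hη in
/-- If `|c| ≤ ε²` on `[0, τ]` (`τ ≤ 8/5`), then `b(t) ≥ b(r) - (Mε³ + δ)(t - r)` for
`0 ≤ r ≤ t ≤ τ`. [cite: Tao2016AveragedNS, §5.5 (5.5)] -/
theorem b_sub_ge_of_smallH {τ : ℝ} (hτ : τ ≤ 8 / 5) (hc : ∀ t ∈ Icc (0 : ℝ) τ, |Y t 2| ≤ ε ^ 2)
    {r t : ℝ} (hr : 0 ≤ r) (hrt : r ≤ t) (ht : t ≤ τ) :
    Y r 1 - (M * ε ^ 3 + δ) * (t - r) ≤ Y t 1 := by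
  obtain ⟨hM6000, -, -, -, -, -, -, -, -⟩ := ignition_params hK hML hMK hε hεle
  obtain ⟨k, hk⟩ : ∃ k : ℝ, k = M * ε ^ 3 + δ := ⟨_, rfl⟩
  have hmono := Thm53.monotoneOn_sub_of_le_deriv (s := Icc (0 : ℝ) τ) (f := fun s => Y s 1)
    (φ := fun _ => -k) (Φ := fun u => -k * u) (convex_Icc 0 _)
    (fun u _ => hasDerivAt_coord (hY u) 1)
    (fun u _ => by simpa using (hasDerivAt_id u).const_mul (-k))
    (fun u hu => by
      have hu' : u ∈ Icc (0 : ℝ) (8 / 5) := ⟨hu.1, hu.2.trans hτ⟩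
      have hθ := (abs_le.1 (abs_coord_defect_le (hV u (mem_Ico_of_mem_window hT hu')) 1)).1
      rw [field_one] at hθ
      have hc2 : Y u 2 ^ 2 ≤ (ε ^ 2) ^ 2 := by
        rw [← sq_abs]; exact pow_le_pow_left₀ (abs_nonneg _) (hc u hu) 2
      have h1 : 0 ≤ ε * Y u 0 ^ 2 := by positivity
      have h2 : ε⁻¹ * M * Y u 2 ^ 2 ≤ ε⁻¹ * M * (ε ^ 2) ^ 2 :=
        mul_le_mul_of_nonneg_left hc2 (by have : (0 : ℝ) ≤ M := by linarith
                                          positivity)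
      have h3 : ε⁻¹ * M * (ε ^ 2) ^ 2 = M * ε ^ 3 := by field_simp
      show -k ≤ V u 1
      rw [hk]; linarith)
  have h := hmono ⟨hr, hrt.trans ht⟩ ⟨hr.trans hrt, ht⟩ hrt
  simp only at h
  rw [← hk]; linarith

omit hR in
/-- If `|c| ≤ ε²` on `[0, τ]` (`τ ≤ 8/5`), the clock integral stays `≥ -1/100` on `[0, τ]`.
[cite: Tao2016AveragedNS, §5.5] -/
theorem clockInt_ge_of_smallH' {τ : ℝ} (hτ : τ ≤ 8 / 5)
    (hc : ∀ t ∈ Icc (0 : ℝ) τ, |Y t 2| ≤ ε ^ 2) {u : ℝ} (hu : u ∈ Icc (0 : ℝ) τ) :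
    -(1 / 100) ≤ clockInt ε M Y u := by
  obtain ⟨hM6000, hε1, hε2, hexpM, hMe, hMe2, hMse, h77, hsM⟩ := ignition_params hK hML hMK hε hεle
  obtain ⟨hδ₀, hδ, hη8, hδ₀1, h732, hs1⟩ := budget_facts' hV hT hK hML hMK hε hεle h0 hη
  have hM0 : 0 < M := by linarith
  have hb0 := (abs_le.1 (abs_init_coord_le h0).1).1
  obtain ⟨β, hβ⟩ : ∃ β : ℝ, β = δ₀ + 8 / 5 * (M * ε ^ 3 + δ) := ⟨_, rfl⟩
  have hβ0 : 0 ≤ β := by rw [hβ]; positivity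
  have hbfloor : ∀ v ∈ Icc (0 : ℝ) τ, -β ≤ Y v 1 := by
    intro v hv
    have h := b_sub_ge_of_smallH hY hV hT hK hML hMK hε hεle hτ hc le_rfl hv.1 hv.2
    have h1 : (M * ε ^ 3 + δ) * (v - 0) ≤ (M * ε ^ 3 + δ) * (8 / 5) :=
      mul_le_mul_of_nonneg_left (by linarith [hv.2]) (by positivity)
    rw [hβ]; linarith
  have hfl : ε⁻¹ * M * β ≤ 1 / 160 := by
    have h1 : ε⁻¹ * M * β = ε⁻¹ * M * (δ₀ + 8 / 5 * δ) + 8 / 5 * (M ^ 2 * ε ^ 2) := by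
      rw [hβ]; field_simp; ring
    have h2 : ε⁻¹ * M * (δ₀ + 8 / 5 * δ) ≤ ε⁻¹ * M * (ε ^ 2 * exp (-M) / 8) :=
      mul_le_mul_of_nonneg_left (by linarith) (by positivity)
    have h3 : ε⁻¹ * M * (ε ^ 2 * exp (-M) / 8) = M * ε * exp (-M) / 8 := by field_simp
    have h4 : M * ε * exp (-M) ≤ 1 / 40 :=
      (mul_le_of_le_one_right (by positivity) (by linarith)).trans hMe
    linarith
  have hmono := Thm53.monotoneOn_sub_of_le_deriv (s := Icc (0 : ℝ) τ)
    (f := clockInt ε M Y) (φ := fun _ => -(ε⁻¹ * M * β))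
    (Φ := fun v => -(ε⁻¹ * M * β) * v) (convex_Icc 0 _)
    (fun v _ => hasDerivAt_clockIntA hY v)
    (fun v _ => by simpa using (hasDerivAt_id v).const_mul (-(ε⁻¹ * M * β)))
    (fun v hv => by
      have h1 : ε⁻¹ * M * (-β) ≤ ε⁻¹ * M * Y v 1 :=
        mul_le_mul_of_nonneg_left (hbfloor v hv) (by positivity)
      linarith)
  have h := hmono (left_mem_Icc.2 (hu.1.trans hu.2)) hu hu.1
  simp only [clockInt_zero, mul_zero, sub_zero] at h
  have h5 : ε⁻¹ * M * β * u ≤ 1 / 160 * (8 / 5) := mul_le_mul hfl (hu.2.trans hτ) hu.1 (by norm_num)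
  linarith

/-- If `|c| ≤ ε²` on `[0, τ]` (`τ ≤ 8/5`), the clock is still running on `[1, τ]`: `b ≥ (49/50)ε`.
[cite: Tao2016AveragedNS, §5.5 (5.5)] -/
theorem b_ge_late_of_smallH' {τ : ℝ} (hτ : τ ≤ 8 / 5)
    (hc : ∀ t ∈ Icc (0 : ℝ) τ, |Y t 2| ≤ ε ^ 2) {t : ℝ} (ht : t ∈ Icc (1 : ℝ) τ) :
    49 / 50 * ε ≤ Y t 1 := by
  obtain ⟨hM6000, hε1, hε2, hexpM, hMe, hMe2, hMse, h77, hsM⟩ := ignition_params hK hML hMK hε hεle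
  obtain ⟨hδ₀, hδ, hη8, hδ₀1, h732, hs1⟩ := budget_facts' hV hT hK hML hMK hε hεle h0 hη
  have h1 := b_ge_unit' hY hV hR hT hK hML hMK hε hεle h0 hη (t := 1) ⟨zero_le_one, le_rfl⟩
  have h2 := b_sub_ge_of_smallH hY hV hT hK hML hMK hε hεle hτ hc zero_le_one ht.1 ht.2
  have hε300 : ε ≤ 1 / 300 :=
    le_of_pow_le_pow_left₀ two_ne_zero (by norm_num) (hε2.trans (by norm_num))
  have h3 : M * ε ^ 3 = M * ε * ε ^ 2 := by ring
  have h4 : M * ε * ε ^ 2 ≤ 1 / 40 * ε ^ 2 := mul_le_mul_of_nonneg_right hMe (sq_nonneg ε)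
  have h5 : ε ^ 2 ≤ ε * (1 / 300) := by rw [sq]; exact mul_le_mul_of_nonneg_left hε300 hε.le
  have h6 : ε ^ 2 * exp (-M) ≤ ε ^ 2 := mul_le_of_le_one_right (sq_nonneg ε) (by linarith)
  have h7 : (M * ε ^ 3 + δ) * (t - 1) ≤ (M * ε ^ 3 + δ) * (3 / 5) :=
    mul_le_mul_of_nonneg_left (by linarith [ht.2]) (by positivity)
  linarith

/-- If `|c| ≤ ε²` on `[0, τ]` (`τ ≤ 8/5`), the clock mode stays in `[-2ε, 2ε]` on `[0, τ]`.
[cite: Tao2016AveragedNS, §5.5 (5.5)] -/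
theorem abs_b_le_of_smallH' {τ : ℝ} (hτ : τ ≤ 8 / 5)
    (hc : ∀ t ∈ Icc (0 : ℝ) τ, |Y t 2| ≤ ε ^ 2) {t : ℝ} (ht : t ∈ Icc (0 : ℝ) τ) :
    |Y t 1| ≤ 2 * ε := by
  obtain ⟨hM6000, hε1, hε2, hexpM, hMe, hMe2, hMse, h77, hsM⟩ := ignition_params hK hML hMK hε hεle
  obtain ⟨hδ₀, hδ, hη8, hδ₀1, h732, hs1⟩ := budget_facts' hV hT hK hML hMK hε hεle h0 hη
  have ht' : t ∈ Icc (0 : ℝ) (8 / 5) := ⟨ht.1, ht.2.trans hτ⟩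
  have hM : (0 : ℝ) ≤ M := by linarith
  have hup := b_le hY hV hR hT h0 hδ₀1 hε hM ht'
  have hb0 := (abs_le.1 (abs_init_coord_le h0).1).1
  have hlow := b_sub_ge_of_smallH hY hV hT hK hML hMK hε hεle hτ hc le_rfl ht.1 ht.2
  have hε300 : ε ≤ 1 / 300 :=
    le_of_pow_le_pow_left₀ two_ne_zero (by norm_num) (hε2.trans (by norm_num))
  have h3 : M * ε ^ 3 = M * ε * ε ^ 2 := by ring
  have h4 : M * ε * ε ^ 2 ≤ 1 / 40 * ε ^ 2 := mul_le_mul_of_nonneg_right hMe (sq_nonneg ε)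
  have h5 : ε ^ 2 ≤ ε * (1 / 300) := by rw [sq]; exact mul_le_mul_of_nonneg_left hε300 hε.le
  have h6 : ε ^ 2 * exp (-M) ≤ ε ^ 2 := mul_le_of_le_one_right (sq_nonneg ε) (by linarith)
  have h7 : (M * ε ^ 3 + δ) * (t - 0) ≤ (M * ε ^ 3 + δ) * (8 / 5) :=
    mul_le_mul_of_nonneg_left (by linarith [ht'.2]) (by positivity)
  have h8 : (ε * (1 + 7 * δ₀ + 32 * δ) + δ) * t ≤ (ε * (1 + 7 * δ₀ + 32 * δ) + δ) * (8 / 5) :=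
    mul_le_mul_of_nonneg_left ht'.2 (by positivity)
  have h9 : ε * (7 * δ₀ + 32 * δ) ≤ 1 / 300 * (2 * (ε ^ 2 * exp (-M))) :=
    mul_le_mul hε300 h732 (by positivity) (by norm_num)
  rw [abs_le]; constructor <;> linarith

/-! ### The trigger level `ε²/K¹⁰` (budget-free facts) -/

omit hY hV hR hT h0 hη in
/-- The trigger level of `Thm53With` is ABOVE everything the quiet phase produces on `[0,1]` and
above the budget: `3ε²e^{-M/2} < ε²/K¹⁰`, `e^{-M} ≤ 1/(3K¹⁰)`; and `ε²/K¹⁰ ≤ ε²`, `1/K¹⁰ ≤ 10⁻¹²`.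
[cite: Tao2016AveragedNS, §5.5 (tcable)] -/
theorem level_facts :
    0 < ε ^ 2 / K ^ 10 ∧ ε ^ 2 / K ^ 10 ≤ ε ^ 2 ∧ 3 * ε ^ 2 * exp (-(M / 2)) < ε ^ 2 / K ^ 10 ∧
      exp (-M) ≤ 1 / (3 * K ^ 10) ∧ 1 / K ^ 10 ≤ 1 / 1000000000000 := by
  obtain ⟨hK16, hM4, hε1, -, -, -⟩ := negKick_params hK hML hMK hε hεle
  have hK0 : 0 < K := by linarith
  have hK1 : 1 ≤ K := by linarith
  obtain ⟨-, -, hlog0⟩ := Thm53With.log_facts hK16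
  have hpow : 1 ≤ K ^ 10 := one_le_pow₀ hK1
  have hℓε : ε ^ 2 / K ^ 10 ≤ ε ^ 2 := div_le_self (sq_nonneg ε) hpow
  -- e^{-M/2} ≤ e^{-12 log K} = K⁻¹² ≤ 1/(9K¹⁰) (uses `K² ≥ 9`)
  have h1 : exp (-(M / 2)) ≤ exp (-(12 * Real.log K)) := exp_le_exp.2 (by nlinarith)
  have h2 : exp (-(12 * Real.log K)) = (K ^ 12)⁻¹ := by
    rw [exp_neg, show (12 : ℝ) * Real.log K = ((12 : ℕ) : ℝ) * Real.log K by norm_num,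
      Real.exp_nat_mul, Real.exp_log hK0]
  have h3 : (K ^ 12)⁻¹ ≤ 1 / (9 * K ^ 10) := by
    rw [inv_eq_one_div]
    refine one_div_le_one_div_of_le (by positivity) ?_
    calc 9 * K ^ 10 ≤ K ^ 2 * K ^ 10 :=
        mul_le_mul_of_nonneg_right (by nlinarith) (pow_pos hK0 10).le
      _ = K ^ 12 := by ring
  have hhalf : exp (-(M / 2)) ≤ 1 / (9 * K ^ 10) := h1.trans (h2.le.trans h3)
  have hfull : exp (-M) ≤ 1 / (3 * K ^ 10) := by
    have : exp (-M) ≤ exp (-(M / 2)) := exp_le_exp.2 (by linarith)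
    have h9 : 1 / (9 * K ^ 10) ≤ 1 / (3 * K ^ 10) :=
      one_div_le_one_div_of_le (by positivity) (by nlinarith [pow_pos hK0 10])
    linarith
  have hlt : 3 * ε ^ 2 * exp (-(M / 2)) < ε ^ 2 / K ^ 10 := by
    have hε2 : 0 < ε ^ 2 := pow_pos hε 2
    have h4 : 3 * ε ^ 2 * exp (-(M / 2)) ≤ 3 * ε ^ 2 * (1 / (9 * K ^ 10)) :=
      mul_le_mul_of_nonneg_left hhalf (by positivity)
    have h5 : 3 * ε ^ 2 * (1 / (9 * K ^ 10)) = ε ^ 2 / K ^ 10 / 3 := by field_simp; ring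
    have h6 : 0 < ε ^ 2 / K ^ 10 := by positivity
    linarith
  have hK10 : 1 / K ^ 10 ≤ 1 / 1000000000000 := by
    have : (16 : ℝ) ^ 10 ≤ K ^ 10 := pow_le_pow_left₀ (by norm_num) hK16 10
    exact one_div_le_one_div_of_le (by norm_num) (le_trans (by norm_num) this)
  exact ⟨by positivity, hℓε, hlt, hfull, hK10⟩

end Eighth

section Seed

variable (hK : 2 * 20 ^ 42 * (Nat.factorial 42 : ℝ) + 16 ≤ K) (hML : 3000 * Real.log K ≤ M)
  (hMK : M ≤ K ^ 10) (hε : 0 < ε) (hεle : ε ≤ exp (-(10 * M)) / K ^ 100)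
  (h0 : ‖Y 0 - delayInit‖ ≤ δ₀) (hη : δ₀ + 2 * δ ≤ ε ^ 2 * exp (-M) / (8 * Real.sqrt M))
include hK hML hMK hε hεle h0 hη

omit hR in
/-- If `|c| ≤ ε²` on `[0, τ]` (`τ ≤ 8/5`), the clock integral stays `≥ -1/100` on `[0, τ]`.
[cite: Tao2016AveragedNS, §5.5] -/
theorem clockInt_ge_of_smallH {τ : ℝ} (hτ : τ ≤ 8 / 5)
    (hc : ∀ t ∈ Icc (0 : ℝ) τ, |Y t 2| ≤ ε ^ 2) {u : ℝ} (hu : u ∈ Icc (0 : ℝ) τ) :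
    -(1 / 100) ≤ clockInt ε M Y u :=
  clockInt_ge_of_smallH' hY hV hT hK hML hMK hε hεle h0 (budget_le_eighth hK hML hMK hε hεle hη) hτ hc hu

/-- If `|c| ≤ ε²` on `[0, τ]` (`τ ≤ 8/5`), the clock is still running on `[1, τ]`: `b ≥ (49/50)ε`.
[cite: Tao2016AveragedNS, §5.5 (5.5)] -/
theorem b_ge_late_of_smallH {τ : ℝ} (hτ : τ ≤ 8 / 5)
    (hc : ∀ t ∈ Icc (0 : ℝ) τ, |Y t 2| ≤ ε ^ 2) {t : ℝ} (ht : t ∈ Icc (1 : ℝ) τ) :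
    49 / 50 * ε ≤ Y t 1 :=
  b_ge_late_of_smallH' hY hV hR hT hK hML hMK hε hεle h0 (budget_le_eighth hK hML hMK hε hεle hη) hτ hc ht

/-- If `|c| ≤ ε²` on `[0, τ]` (`τ ≤ 8/5`), the clock mode stays in `[-2ε, 2ε]` on `[0, τ]`.
[cite: Tao2016AveragedNS, §5.5 (5.5)] -/
theorem abs_b_le_of_smallH {τ : ℝ} (hτ : τ ≤ 8 / 5)
    (hc : ∀ t ∈ Icc (0 : ℝ) τ, |Y t 2| ≤ ε ^ 2) {t : ℝ} (ht : t ∈ Icc (0 : ℝ) τ) :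
    |Y t 1| ≤ 2 * ε :=
  abs_b_le_of_smallH' hY hV hR hT hK hML hMK hε hεle h0 (budget_le_eighth hK hML hMK hε hεle hη) hτ hc ht

/-- If `|c| ≤ ε²` on `[0, τ]` (`τ ≤ 8/5`), the discounted trigger keeps its window deposit on
`[1/√M, τ]`: `D ≥ (13/40)·ε²e^{-M}/√M`; in particular `c > 0` there.
[cite: Tao2016AveragedNS, §5.5] -/
theorem disc_ge_of_smallH {τ : ℝ} (hτ : τ ≤ 8 / 5)
    (hc : ∀ t ∈ Icc (0 : ℝ) τ, |Y t 2| ≤ ε ^ 2) {t : ℝ} (ht : t ∈ Icc (Real.sqrt M)⁻¹ τ) :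
    13 / 40 * (ε ^ 2 * exp (-M)) / Real.sqrt M ≤ Y t 2 * exp (-clockInt ε M Y t) := by
  obtain ⟨hM6000, hε1, hε2, hexpM, hMe, hMe2, hMse, h77, hsM⟩ := ignition_params hK hML hMK hε hεle
  obtain ⟨hδ₀, hδ, hη8, hδ₀1, h732, hs1⟩ := budget_facts hV hT hK hML hMK hε hεle h0 hη
  have hsq0 : 0 < Real.sqrt M := by linarith
  have hu₀0 : 0 < (Real.sqrt M)⁻¹ := by positivity
  have hwin := disc_window hY hV hR hT hK hML hMK hε hεle h0 hη
  have hp := disc_persist hY hV hT hK hML hMK hε hεle h0 hη (τ := τ) hτ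
    (fun u hu => clockInt_ge_of_smallH hY hV hT hK hML hMK hε hεle h0 hη hτ hc hu) hu₀0.le ht.1 ht.2
  have h1 : 102 / 100 * δ * (t - (Real.sqrt M)⁻¹) ≤ 102 / 100 * δ * (8 / 5) :=
    mul_le_mul_of_nonneg_left (by linarith [ht.2]) (by positivity)
  have h2 : δ₀ + 2 * δ ≤ ε ^ 2 * exp (-M) / 8 / Real.sqrt M := by
    rw [div_div]; simpa [mul_comm] using hη
  have h3 : 13 / 40 * (ε ^ 2 * exp (-M)) / Real.sqrt M =
      9 / 20 * (ε ^ 2 * exp (-M)) / Real.sqrt M - ε ^ 2 * exp (-M) / 8 / Real.sqrt M := by ring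
  rw [h3]
  linarith

/-- If `|c| ≤ ε²` on `[0, τ]` (`τ ≤ 8/5`), then `c > 0` on `[1/√M, τ]`. [cite: Tao2016AveragedNS, §5.5] -/
theorem c_pos_of_smallH {τ : ℝ} (hτ : τ ≤ 8 / 5)
    (hc : ∀ t ∈ Icc (0 : ℝ) τ, |Y t 2| ≤ ε ^ 2) {t : ℝ} (ht : t ∈ Icc (Real.sqrt M)⁻¹ τ) :
    0 < Y t 2 := by
  obtain ⟨hM6000, -, -, -, -, -, -, h77, -⟩ := ignition_params hK hML hMK hε hεle
  have hD := disc_ge_of_smallH hY hV hR hT hK hML hMK hε hεle h0 hη hτ hc ht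
  have hpos : 0 < 13 / 40 * (ε ^ 2 * exp (-M)) / Real.sqrt M := by
    have : 0 < Real.sqrt M := by linarith
    positivity
  by_contra hle
  have : Y t 2 * exp (-clockInt ε M Y t) ≤ 0 :=
    mul_nonpos_of_nonpos_of_nonneg (le_of_not_gt hle) (exp_pos _).le
  linarith

/-! ## §3. The trigger level `ε²/K¹⁰` and its first hitting time -/

/-- **The trigger-level hitting time of an approximate trajectory.** Under the standing hypotheses
and the seed-scale budget `δ₀ + 2δ ≤ ε²e^{-M}/(8√M)` there is `τ ∈ (1, 8/5]` at which the trigger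
FIRST reaches `Thm53With`'s level: `c(τ) = ε²/K¹⁰`, `|c| < ε²/K¹⁰` on `[0, τ)`; moreover `c > 0` on
`[1/√M, τ]`, `b ≥ (49/50)ε` on `[1, τ]`, and on `[0, τ]`: `|b| ≤ 2ε`, `a² ≥ 999/1000`,
`|d|, |ã| ≤ 4/K¹⁰`. [cite: Tao2016AveragedNS, §5.5 Theorem 5.3 (tcable)] -/
theorem exists_triggerLevel_hit :
    ∃ τ ∈ Ioc (1 : ℝ) (8 / 5), Y τ 2 = ε ^ 2 / K ^ 10 ∧
      (∀ t ∈ Ico (0 : ℝ) τ, |Y t 2| < ε ^ 2 / K ^ 10) ∧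
      (∀ t ∈ Icc (Real.sqrt M)⁻¹ τ, 0 < Y t 2) ∧
      (∀ t ∈ Icc (1 : ℝ) τ, 49 / 50 * ε ≤ Y t 1) ∧
      (∀ t ∈ Icc (0 : ℝ) τ, |Y t 1| ≤ 2 * ε ∧ 999 / 1000 ≤ Y t 0 ^ 2 ∧
        |Y t 3| ≤ 4 / K ^ 10 ∧ |Y t 4| ≤ 4 / K ^ 10) := by
  obtain ⟨hM6000, hε1, hε2, hexpM, hMe, hMe2, hMse, h77, hsM⟩ := ignition_params hK hML hMK hε hεle
  obtain ⟨hδ₀, hδ, hη8, hδ₀1, h732, hs1⟩ := budget_facts hV hT hK hML hMK hε hεle h0 hη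
  obtain ⟨hℓ0, hℓε, hℓ3, hsK, hK10⟩ := level_facts hK hML hMK hε hεle
  obtain ⟨ℓ, hℓ⟩ : ∃ ℓ : ℝ, ℓ = ε ^ 2 / K ^ 10 := ⟨_, rfl⟩
  rw [← hℓ] at hℓ0 hℓε hℓ3 ⊢
  have hsq1 : 1 ≤ Real.sqrt M := by linarith
  -- the closed set of window times at which `|c| ≥ ℓ`, and its infimum
  obtain ⟨t₀, ht₀, hgt⟩ := exists_abs_c_gt_sq hY hV hR hT hK hML hMK hε hεle h0 hη
  obtain ⟨S, hS⟩ : ∃ S : Set ℝ, S = Icc (0 : ℝ) (8 / 5) ∩ {t | ℓ ≤ |Y t 2|} := ⟨_, rfl⟩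
  have hne : S.Nonempty := ⟨t₀, by rw [hS]; exact ⟨ht₀, hℓε.trans hgt.le⟩⟩
  have hbdd : BddBelow S := ⟨0, fun t ht => by rw [hS] at ht; exact ht.1.1⟩
  have hcl : IsClosed S := by
    rw [hS]
    exact isClosed_Icc.inter (isClosed_le continuous_const (continuous_coord hY 2).abs)
  obtain ⟨τ, hτ⟩ : ∃ τ : ℝ, τ = sInf S := ⟨_, rfl⟩
  have hmem : τ ∈ S := by rw [hτ]; exact hcl.csInf_mem hne hbdd
  have hτS : τ ∈ Icc (0 : ℝ) (8 / 5) ∧ ℓ ≤ |Y τ 2| := by rw [hS] at hmem; exact hmem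
  have hτ85 : τ ≤ 8 / 5 := hτS.1.2
  have hbefore : ∀ t ∈ Icc (0 : ℝ) (8 / 5), t < τ → |Y t 2| < ℓ := by
    intro t ht htτ
    by_contra hge
    have htS : t ∈ S := by rw [hS]; exact ⟨ht, le_of_not_gt hge⟩
    have := csInf_le hbdd htS
    rw [← hτ] at this
    linarith
  -- `τ > 1`: on `[0,1]` the trigger is below `3ε²e^{-M/2} < ℓ`
  have hτ1 : 1 < τ := by
    by_contra hle
    have h := abs_c_le_unit hY hV hR hT hK hML hMK hε hεle h0 hη ⟨hτS.1.1, le_of_not_gt hle⟩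
    linarith [hτS.2]
  -- `|c(τ)| = ℓ` by the intermediate value theorem and minimality
  have hc0 : |Y 0 2| < ℓ := by
    have h := (abs_init_coord_le h0).2.1
    have : ε ^ 2 * exp (-M) ≤ ε ^ 2 * exp (-(M / 2)) :=
      mul_le_mul_of_nonneg_left (exp_le_exp.2 (by linarith)) (sq_nonneg ε)
    linarith
  have habsτ : |Y τ 2| = ℓ := by
    have hcont : ContinuousOn (fun t => |Y t 2|) (Icc 0 τ) :=
      ((continuous_coord hY 2).abs).continuousOn
    obtain ⟨t, ht, hteq⟩ := intermediate_value_Icc hτS.1.1 hcont ⟨hc0.le, hτS.2⟩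
    have htS : t ∈ S := by rw [hS]; exact ⟨⟨ht.1, ht.2.trans hτ85⟩, hteq.ge⟩
    have hτt : τ ≤ t := by rw [hτ]; exact csInf_le hbdd htS
    have hte : t = τ := le_antisymm ht.2 hτt
    rw [← hte]; exact hteq
  have hcℓ : ∀ t ∈ Icc (0 : ℝ) τ, |Y t 2| ≤ ℓ := fun t ht => by
    rcases eq_or_lt_of_le ht.2 with h | h
    · rw [h, habsτ]
    · exact (hbefore t ⟨ht.1, ht.2.trans hτ85⟩ h).le
  have hcε : ∀ t ∈ Icc (0 : ℝ) τ, |Y t 2| ≤ ε ^ 2 := fun t ht => (hcℓ t ht).trans hℓε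
  -- sign at `τ`
  have hu₀τ : (Real.sqrt M)⁻¹ ≤ τ := (inv_le_one_of_one_le₀ hsq1).trans hτ1.le
  have hposτ := c_pos_of_smallH hY hV hR hT hK hML hMK hε hεle h0 hη hτ85 hcε ⟨hu₀τ, le_rfl⟩
  have hceq : Y τ 2 = ℓ := by rw [← habsτ, abs_of_pos hposτ]
  refine ⟨τ, ⟨hτ1, hτ85⟩, hceq, fun t ht => hbefore t ⟨ht.1, ht.2.le.trans hτ85⟩ ht.2,
    fun t ht => c_pos_of_smallH hY hV hR hT hK hML hMK hε hεle h0 hη hτ85 hcε ht,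
    fun t ht => b_ge_late_of_smallH hY hV hR hT hK hML hMK hε hεle h0 hη hτ85 hcε ht,
    fun t ht => ?_⟩
  have hb := abs_b_le_of_smallH hY hV hR hT hK hML hMK hε hεle h0 hη hτ85 hcε ht
  have hde := de_le_of_abs_c_le hY hV hR hT h0 hε hℓ0.le hτ85 hcℓ ht
  -- `2δ₀ + (2δ + 2ℓ/ε²)t ≤ 4/K¹⁰`
  have hℓK : 2 * ℓ / ε ^ 2 = 2 / K ^ 10 := by rw [hℓ]; field_simp
  rw [hℓK] at hde
  have hsmall : 2 * δ₀ + (2 * δ + 2 / K ^ 10) * t ≤ 4 / K ^ 10 := by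
    have ht85 : t ≤ 8 / 5 := ht.2.trans hτ85
    have h1 : (2 * δ + 2 / K ^ 10) * t ≤ (2 * δ + 2 / K ^ 10) * (8 / 5) :=
      mul_le_mul_of_nonneg_left ht85 (by positivity)
    have h2 : ε ^ 2 * exp (-M) ≤ 1 * (1 / (3 * K ^ 10)) :=
      mul_le_mul (by nlinarith) hsK (exp_pos _).le zero_le_one
    have h3 : 1 * (1 / (3 * K ^ 10)) = 1 / K ^ 10 / 3 := by ring
    have h4 : 0 < 1 / K ^ 10 := by
      have h20 : (0 : ℝ) ≤ 2 * 20 ^ 42 * (Nat.factorial 42 : ℝ) := by positivity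
      have : 0 < K := by linarith
      positivity
    have hw4 : 4 / K ^ 10 = 4 * (1 / K ^ 10) := by ring
    have hw2 : (2 * δ + 2 / K ^ 10) * (8 / 5) = 16 / 5 * δ + 16 / 5 * (1 / K ^ 10) := by ring
    linarith
  have hd : |Y t 3| ≤ 4 / K ^ 10 := hde.1.trans hsmall
  have he : |Y t 4| ≤ 4 / K ^ 10 := hde.2.trans hsmall
  -- the carrier: `a² = energy - b² - c² - d² - ã² ≥ 1 - 2ε²e^{-M} - 4ε² - ℓ² - 32/K²⁰`
  have ha : 999 / 1000 ≤ Y t 0 ^ 2 := by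
    have hE := abs_energy_sub_one_le hY hV hR hT h0 hδ₀1 (t := t) ⟨ht.1, ht.2.trans hτ85⟩
    rw [energy_five] at hE
    have hE1 := (abs_le.1 hE).1
    have hb2 : Y t 1 ^ 2 ≤ (2 * ε) ^ 2 := by
      rw [← sq_abs]; exact pow_le_pow_left₀ (abs_nonneg _) hb 2
    have hc2 : Y t 2 ^ 2 ≤ (ε ^ 2) ^ 2 := by
      rw [← sq_abs]; exact pow_le_pow_left₀ (abs_nonneg _) (hcε t ht) 2
    have hd2 : Y t 3 ^ 2 ≤ (4 / K ^ 10) ^ 2 := by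
      rw [← sq_abs]; exact pow_le_pow_left₀ (abs_nonneg _) hd 2
    have he2 : Y t 4 ^ 2 ≤ (4 / K ^ 10) ^ 2 := by
      rw [← sq_abs]; exact pow_le_pow_left₀ (abs_nonneg _) he 2
    have hw4 : 4 / K ^ 10 = 4 * (1 / K ^ 10) := by ring
    have hK4 : 4 / K ^ 10 ≤ 4 / 1000000000000 := by rw [hw4]; linarith
    have hK40 : 0 ≤ 4 / K ^ 10 := by
      have h20 : (0 : ℝ) ≤ 2 * 20 ^ 42 * (Nat.factorial 42 : ℝ) := by positivity
      have : 0 < K := by linarith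
      positivity
    have hK2 : (4 / K ^ 10) ^ 2 ≤ 4 / K ^ 10 * (4 / 1000000000000) := by
      rw [sq]; exact mul_le_mul_of_nonneg_left hK4 hK40
    have hK3 : 4 / K ^ 10 * (4 / 1000000000000) ≤ 4 / 1000000000000 * (4 / 1000000000000) :=
      mul_le_mul_of_nonneg_right hK4 (by norm_num)
    have hε4 : (ε ^ 2) ^ 2 ≤ ε ^ 2 * (1 / 100000) := by
      rw [sq]; exact mul_le_mul_of_nonneg_left hε2 (sq_nonneg ε)
    have hε5 : ε ^ 2 * (1 / 100000) ≤ 1 / 100000 * (1 / 100000) :=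
      mul_le_mul_of_nonneg_right hε2 (by norm_num)
    have hb3 : (2 * ε) ^ 2 = 4 * ε ^ 2 := by ring
    linarith
  exact ⟨hb, ha, hd, he⟩

end Seed

end Approx

end Ignition

/-! ## §4. Exported statement -/

/-- **The trigger-level hitting time of an approximate trajectory (explicit hypotheses).** For
every member `delayCircuitWith K M ε` under the standing hypotheses of the family and every
differentiable approximate trajectory `Y` (velocity `V`, sup-defect `≤ δ` and sup-norm `≤ 2` on
`[0,T)`, `T ≥ 2`) issued `δ₀`-close to Tao's datum (5.6) with `δ₀ + δT ≤ ε²e^{-M}/(8√M)`: there is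
`τ ∈ (1, 8/5]` with `c(τ) = ε²/K¹⁰`, `|c| < ε²/K¹⁰` on `[0,τ)`, `c > 0` on `[1/√M, τ]`,
`b ≥ (49/50)ε` on `[1, τ]`, and `|b| ≤ 2ε`, `a² ≥ 999/1000`, `|d|, |ã| ≤ 4/K¹⁰` on `[0, τ]` — the
entry state of Tao's transition phase [Tao2016AveragedNS, §5.5 (tcable), (able2)], for pseudo-orbits.
[cite: Tao2016AveragedNS, §5.5 Theorem 5.3] -/
theorem triggerLevel_hit (K M ε δ δ₀ T : ℝ) (Y V : ℝ → Fin 5 → ℝ)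
    (hK : 2 * 20 ^ 42 * (Nat.factorial 42 : ℝ) + 16 ≤ K) (hML : 3000 * Real.log K ≤ M)
    (hMK : M ≤ K ^ 10) (hε : 0 < ε) (hεle : ε ≤ exp (-(10 * M)) / K ^ 100) (hT : 2 ≤ T)
    (hY : ∀ t, HasDerivAt Y (V t) t)
    (hV : ∀ t ∈ Ico 0 T, ‖V t - delayCircuitWith K M ε (Y t)‖ ≤ δ)
    (hR : ∀ t ∈ Ico 0 T, ‖Y t‖ ≤ 2) (h0 : ‖Y 0 - delayInit‖ ≤ δ₀)
    (hB : δ₀ + δ * T ≤ ε ^ 2 * exp (-M) / (8 * Real.sqrt M)) :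
    ∃ τ ∈ Ioc (1 : ℝ) (8 / 5), Y τ 2 = ε ^ 2 / K ^ 10 ∧
      (∀ t ∈ Ico (0 : ℝ) τ, |Y t 2| < ε ^ 2 / K ^ 10) ∧
      (∀ t ∈ Icc (Real.sqrt M)⁻¹ τ, 0 < Y t 2) ∧
      (∀ t ∈ Icc (1 : ℝ) τ, 49 / 50 * ε ≤ Y t 1) ∧
      (∀ t ∈ Icc (0 : ℝ) τ, |Y t 1| ≤ 2 * ε ∧ 999 / 1000 ≤ Y t 0 ^ 2 ∧
        |Y t 3| ≤ 4 / K ^ 10 ∧ |Y t 4| ≤ 4 / K ^ 10) := by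
  have hδ : 0 ≤ δ := Ignition.defect_nonneg hV hT
  have hη : δ₀ + 2 * δ ≤ ε ^ 2 * exp (-M) / (8 * Real.sqrt M) := by nlinarith
  exact Ignition.exists_triggerLevel_hit hY hV hR hT hK hML hMK hε hεle h0 hη

end Literature.Analysis.FluidPDE.Tao2016AveragedNS
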